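import Summits.MatrixMultiplication.OmegaCensus.STPPVosperSlackTwoSoundA
import Summits.MatrixMultiplication.OmegaCensus.STPPVosperTilingTools
import Literature.Computability.AlgebraicComplexity.STPPLineFamilies
import Literature.Computability.AlgebraicComplexity.STPPGlobalShift

/-!
# ω-census (abelian STPP census): SOUNDNESS of the slack-2 case-A checker — reduction of a case-(A) family to normal form (kernel tool)

HONEST FRAMING (pub-omega census; verbatim): lottery ticket; floor = certified bounds/negative ranges.
Census STRUCTURE (seat pub-omega-stpp-1 gen 32, 2026-08-28), family (b2).  `caseADeadQ'_false_of_isAP`: for a two-block STPP family of `ℤ/p` whose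
block `i` is in case (A) of `slack_two_shapes` (`Aᵢ` and `Y°` progressions of one non-zero difference `d`, `a + L ≤ p`) and ANY `β₀ ∈ Bᵢ`, the checker
`caseADeadQ'` (`STPPVosperSlackTwoCheckers.lean`) returns `false` on the increasing value list of `d⁻¹·(Bᵢ − β₀)`.  Proof = the `N + 2 = 4` translation
freedoms and the dilation (`IsSTPP.comp_of_injective`, `isSTPP_dilate`, `IsSTPP.translate_shiftBC`) bring the family to the normal form of
`caseADeadQ'_false_of_normal_form` (`STPPVosperSlackTwoSoundA.lean`).  So a row `caseADeadQ' … Q = true` for every shape `Q` EXCLUDES case (A); case (B′)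
is case (A) of the role-swapped family; case (C) needs the analogous pair of lemmas for `caseCDeadQP` (successor).  UNCONDITIONAL; no `decide`.
Nothing here is progress on `ω`.

References: H. Cohn, R. Kleinberg, B. Szegedy, C. Umans, FOCS 2005 (arXiv:math/0511460), Def. 5.1; A. G. Vosper, J. London Math. Soc. 31 (1956).
-/

open Finset
open scoped Pointwise

namespace Summit.MatrixMultiplication.OmegaCensus.CubeNB.S2

open Literature.Computability.AlgebraicComplexity
open Literature.Combinatorics.Additive
open Summit.MatrixMultiplication.OmegaCensus.STPPKneser
open Summit.MatrixMultiplication.OmegaCensus.CubeNB.Bits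

variable {p : ℕ} [hp : Fact p.Prime]

/-- **SOUNDNESS of the case-A checker (case (A) of `slack_two_shapes`, two blocks).**  If block `i` of a two-block STPP family of `ℤ/p` has `Aᵢ` and
`Y° = C_{i₀} − B_{i₀}` progressions of the same non-zero difference `d` (with `a + L ≤ p`), then for ANY `β₀ ∈ Bᵢ` the checker `caseADeadQ'` returns
`false` on the increasing value list of `d⁻¹·(Bᵢ − β₀)` — by reduction to the normal form (`IsSTPP.comp_of_injective`, `isSTPP_dilate`,
`IsSTPP.translate_shiftBC`: the `N + 2 = 4` translation freedoms pin `Aᵢ ↦ [0,a)`, `β₀ ↦ 0`, `γ₀ ↦ 0`, an element of `B_{i₀} ↦ 0`).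
[cite: CohnKleinbergSzegedyUmans2005, Def. 5.1] [cite: Vosper1956, main theorem; Nathanson1996, Thm 2.7] -/
theorem caseADeadQ'_false_of_isAP {A B C : Fin 2 → Finset (ZMod p)} (hS : IsSTPP A B C)
    (hA : ∀ k, (A k).Nonempty) (hB : ∀ k, (B k).Nonempty) (hC : ∀ k, (C k).Nonempty) (i i₀ : Fin 2) (hii : i₀ ≠ i)
    {a c L z a₀ b₀ c₀ : ℕ} (ha : #(A i) = a) (hc : #(C i) = c) (ha₀ : #(A i₀) = a₀) (hb₀ : #(B i₀) = b₀) (hc₀ : #(C i₀) = c₀)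
    (hL : b₀ * c₀ = L) (hz : a₀ * c₀ = z) (hap : a + L ≤ p)
    {d : ZMod p} (hd : d ≠ 0) (hAP : IsAP (A i) d) (hYAP : IsAP (DU B C (univ.erase i)) d) {β₀ : ZMod p} (hβ₀ : β₀ ∈ B i) :
    caseADeadQ' p a c L z a₀ b₀ c₀ (((B i).image fun x => (d⁻¹ * (x - β₀)).val).sort (· ≤ ·)) = false := by
  -- the other index
  have hI : (univ : Finset (Fin 2)).erase i = {i₀} := by
    fin_cases i <;> fin_cases i₀ <;> first | exact absurd rfl hii | decide
  set u : ZMod p := d⁻¹ with hu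
  have hu0 : u ≠ 0 := inv_ne_zero hd
  have hud : u * d = 1 := inv_mul_cancel₀ hd
  obtain ⟨α, hAeq⟩ := hAP
  rw [ha] at hAeq
  obtain ⟨y₀, hYeq⟩ := hYAP
  have hYcard : #(DU B C (univ.erase i)) = L := by rw [card_DU_BC hS hA, hI, sum_singleton, hb₀, hc₀, hL]
  rw [hYcard] at hYeq
  obtain ⟨γ₀, hγ₀⟩ := hC i
  obtain ⟨bs, hbs⟩ := hB i₀
  -- reindex: 0 ↦ i, 1 ↦ i₀
  set ι : Fin 2 → Fin 2 := fun k => if k = 0 then i else i₀ with hι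
  have hι0 : ι 0 = i := by simp [hι]
  have hι1 : ι 1 = i₀ := by simp [hι]
  have hιinj : Function.Injective ι := by
    intro k k' hk
    fin_cases k <;> fin_cases k'
    · rfl
    · exfalso; simp [hι] at hk; first | exact hii hk | exact hii hk.symm
    · exfalso; simp [hι] at hk; exact hii hk
    · rfl
  have hS1 : IsSTPP (fun k => A (ι k)) (fun k => B (ι k)) (fun k => C (ι k)) := hS.comp_of_injective ι hιinj
  have hS2 : IsSTPP (fun k => (A (ι k)).image (u * ·)) (fun k => (B (ι k)).image (u * ·)) (fun k => (C (ι k)).image (u * ·)) :=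
    isSTPP_dilate hS1 hu0
  set β : ZMod p := u * α - u * β₀ with hβ
  set γ : ZMod p := u * α - u * γ₀ with hγ
  set t : Fin 2 → ZMod p := fun k => if k = 0 then -(u * α) else -(u * bs) - β with ht
  have ht0 : t 0 = -(u * α) := by simp [ht]
  have ht1 : t 1 = -(u * bs) - β := by simp [ht]
  have hS3 := IsSTPP.translate_shiftBC hS2 t β γ
  -- the normalised family
  set A3 : Fin 2 → Finset (ZMod p) := fun k => ((A (ι k)).image (u * ·)).image (· + t k) with hA3
  set B3 : Fin 2 → Finset (ZMod p) := fun k => (((B (ι k)).image (u * ·)).image (· + t k)).image (· + β) with hB3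
  set C3 : Fin 2 → Finset (ZMod p) := fun k => (((C (ι k)).image (u * ·)).image (· + t k)).image (· + γ) with hC3
  have hS3' : IsSTPP A3 B3 C3 := hS3
  -- memberships in the normalised sets
  have hmemA3 : ∀ k x, x ∈ A3 k ↔ ∃ v ∈ A (ι k), u * v + t k = x := by
    intro k x; simp only [hA3, mem_image, exists_exists_and_eq_and]
  have hmemB3 : ∀ k x, x ∈ B3 k ↔ ∃ v ∈ B (ι k), u * v + t k + β = x := by
    intro k x; simp only [hB3, mem_image, exists_exists_and_eq_and]
  have hmemC3 : ∀ k x, x ∈ C3 k ↔ ∃ v ∈ C (ι k), u * v + t k + γ = x := by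
    intro k x; simp only [hC3, mem_image, exists_exists_and_eq_and]
  have hinjA : ∀ k, Function.Injective fun v : ZMod p => u * v + t k := fun k v v' h => by
    have := mul_left_cancel₀ hu0 (add_right_cancel h); exact this
  have hinjB : ∀ k, Function.Injective fun v : ZMod p => u * v + t k + β := fun k v v' h => by
    have := mul_left_cancel₀ hu0 (add_right_cancel (add_right_cancel h)); exact this
  have hinjC : ∀ k, Function.Injective fun v : ZMod p => u * v + t k + γ := fun k v v' h => by
    have := mul_left_cancel₀ hu0 (add_right_cancel (add_right_cancel h)); exact this
  have hA3eq : ∀ k, A3 k = (A (ι k)).image fun v => u * v + t k := fun k => by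
    ext x; rw [hmemA3, mem_image]
  have hB3eq : ∀ k, B3 k = (B (ι k)).image fun v => u * v + t k + β := fun k => by
    ext x; rw [hmemB3, mem_image]
  have hC3eq : ∀ k, C3 k = (C (ι k)).image fun v => u * v + t k + γ := fun k => by
    ext x; rw [hmemC3, mem_image]
  -- normal-form hypotheses
  have hA3ne : ∀ k, (A3 k).Nonempty := fun k => by rw [hA3eq]; exact (hA _).image _
  have hB3ne : ∀ k, (B3 k).Nonempty := fun k => by rw [hB3eq]; exact (hB _).image _
  have hC3ne : ∀ k, (C3 k).Nonempty := fun k => by rw [hC3eq]; exact (hC _).image _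
  have ha3 : #(A3 0) = a := by rw [hA3eq, card_image_of_injective _ (hinjA 0), hι0, ha]
  have hc3 : #(C3 0) = c := by rw [hC3eq, card_image_of_injective _ (hinjC 0), hι0, hc]
  have ha3₀ : #(A3 1) = a₀ := by rw [hA3eq, card_image_of_injective _ (hinjA 1), hι1, ha₀]
  have hb3₀ : #(B3 1) = b₀ := by rw [hB3eq, card_image_of_injective _ (hinjB 1), hι1, hb₀]
  have hc3₀ : #(C3 1) = c₀ := by rw [hC3eq, card_image_of_injective _ (hinjC 1), hι1, hc₀]
  have hA30 : A3 0 = (Finset.range a).image fun k : ℕ => (k : ZMod p) := by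
    ext x
    rw [hmemA3, hι0, hAeq, ht0, mem_image]
    constructor
    · rintro ⟨v, hv, rfl⟩
      obtain ⟨k, hk, rfl⟩ := mem_apFinset.1 hv
      refine ⟨k, mem_range.2 hk, ?_⟩
      rw [nsmul_eq_mul]; linear_combination (-(k : ZMod p)) * hud
    · rintro ⟨k, hk, rfl⟩
      refine ⟨α + k • d, mem_apFinset.2 ⟨k, mem_range.1 hk, rfl⟩, ?_⟩
      rw [nsmul_eq_mul]; linear_combination (k : ZMod p) * hud
  have hC30 : (0 : ZMod p) ∈ C3 0 := (hmemC3 0 0).2 ⟨γ₀, by rw [hι0]; exact hγ₀, by rw [ht0, hγ]; ring⟩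
  have hB31 : (0 : ZMod p) ∈ B3 1 := (hmemB3 1 0).2 ⟨bs, by rw [hι1]; exact hbs, by rw [ht1]; ring⟩
  have hY3 : DU B3 C3 (univ.erase 0) = (Finset.range L).image fun tt : ℕ => (u * y₀ + γ - β) + (tt : ZMod p) := by
    have h1 : (univ : Finset (Fin 2)).erase 0 = {1} := by decide
    ext x
    rw [h1, DU, Finset.singleton_biUnion, mem_D, mem_image]
    constructor
    · rintro ⟨b3, hb3, c3, hc3, rfl⟩
      obtain ⟨b, hb, rfl⟩ := (hmemB3 1 b3).1 hb3
      obtain ⟨cc, hcc, rfl⟩ := (hmemC3 1 c3).1 hc3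
      rw [hι1] at hb hcc
      have hin : cc - b ∈ DU B C (univ.erase i) := by
        rw [hI]; exact mem_biUnion.2 ⟨i₀, mem_singleton_self _, mem_D.2 ⟨b, hb, cc, hcc, rfl⟩⟩
      rw [hYeq] at hin
      obtain ⟨m, hm, hme⟩ := mem_apFinset.1 hin
      refine ⟨m, mem_range.2 hm, ?_⟩
      have : u * (cc - b) = u * y₀ + m := by
        rw [← hme, nsmul_eq_mul, mul_add, show u * ((m : ZMod p) * d) = m * (u * d) by ring, hud, mul_one]
      linear_combination (-1 : ZMod p) * this
    · rintro ⟨m, hm, rfl⟩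
      have hin : y₀ + m • d ∈ DU B C (univ.erase i) := by rw [hYeq]; exact mem_apFinset.2 ⟨m, mem_range.1 hm, rfl⟩
      rw [hI, DU, Finset.singleton_biUnion, mem_D] at hin
      obtain ⟨b, hb, cc, hcc, hbc⟩ := hin
      refine ⟨u * b + t 1 + β, (hmemB3 1 _).2 ⟨b, by rw [hι1]; exact hb, rfl⟩, u * cc + t 1 + γ, (hmemC3 1 _).2 ⟨cc, by rw [hι1]; exact hcc, rfl⟩, ?_⟩
      have : u * (cc - b) = u * y₀ + m := by
        rw [hbc, nsmul_eq_mul, mul_add, show u * ((m : ZMod p) * d) = m * (u * d) by ring, hud, mul_one]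
      linear_combination this
  -- apply the normal form
  have key := caseADeadQ'_false_of_normal_form hS3' hA3ne hB3ne hC3ne ha3 hc3 ha3₀ hb3₀ hc3₀ hL hz hap hA30 hC30 hB31 hY3
  -- the value list of `B3 0` is the one in the statement
  have hB30 : (B3 0).image ZMod.val = (B i).image fun x => (d⁻¹ * (x - β₀)).val := by
    rw [hB3eq, hι0, image_image]
    refine image_congr fun x _ => ?_
    show (u * x + t 0 + β).val = (d⁻¹ * (x - β₀)).val
    rw [ht0]
    congr 1
    rw [hβ, hu]; ring
  rw [hB30] at key
  exact key

end Summit.MatrixMultiplication.OmegaCensus.CubeNB.S2
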